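import Summits.AnomalousDissipation.AnomalousDissipation.Theses.SawtoothPulseCascade
import Summits.AnomalousDissipation.AnomalousDissipation.Theorems.SawtoothPulseCascadeK3LocalisedClosureApproxBookkeeping
import Summits.AnomalousDissipation.AnomalousDissipation.Theorems.SawtoothPulseCascadeK3LocalisedClosureApproxResponse
import Summits.AnomalousDissipation.AnomalousDissipation.Theorems.SawtoothPulseCascadeApproxEnvelopeBox
import Summits.AnomalousDissipation.AnomalousDissipation.Theorems.SawtoothPulseCascadeLipAgmonEnvelopeMain
import Summits.AnomalousDissipation.AnomalousDissipation.Theorems.SawtoothPulseCascadeLipAgmonCaps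

/-!
# Crux `ApproxSol58` (stmt-AnomalousDissipation-19688), line `lip-agmon` (lead g4): the composition

`approximateSolution_two_of_lipEnvelope`: for `γ ∈ [5,8]`, the per-phase cap `K2″` at the box point
`P = ⟨γ, ¼, 2, 1, 2⟩` together with a geometric CONTINUOUS Lipschitz envelope of the classical linearised
response (ratio `M₁ < (γ²−3)²`; the conclusion of `LipAgmon.lipEnvelope_two_of_caps`) gives
`DriftFree.ApproximateSolution P (γ²−3)`: S1 = `ApproxResponse.responseL2Envelope` (the `L²` envelope),
S3 = `DriftFreeApprox.envelopeBookkeeping` (the two smallness integrals), and the landed interface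
`DriftFreeApprox.approximateSolution_of_envelopes` + `DriftFreeApprox.exists_linearisedResponse`.
`lipEnvelope_two`: the stub `stub_lipEnvelope_two` of the line's skeleton, UNCONDITIONAL given `K2″` at `(γ, 2)` —
`lipEnvelope_two_of_caps` with the caps discharged by `caps_H` / `caps_V` (`c₃ = 8π²`, `c₄ = 80π³/√(2π)`,
`c₅ = 192π⁴`). `approxSol58_two_of`: `K2LinearisedCascadeGrowth → ∀ γ ∈ [5,8], ApproximateSolution
⟨γ,¼,2,1,2⟩ (γ²−3)` — the input of the pre-certified re-glue `k3LocalisedClosure_of_approxSol_two`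
(p-PointGlue), which turns it into the parent crux `K3LocalisedClosure`.
Scope: the sub-box `ρN = 2` of the item ApproxSol58 (the glue of K3loc consumes `(5, 2)` only); for
`ρN ≥ 3` the per-phase Lipschitz ratio `2ρN·μ·R_V` is not below `(γ²−3)⁴` from `K2″` alone.
-/

set_option linter.dupNamespace false

noncomputable section

namespace Summit.AnomalousDissipation.AnomalousDissipation.Theorems.SawtoothPulseCascade.LipAgmon

open Set MeasureTheory
open scoped InnerProductSpace
open Literature.Analysis Literature.Analysis.FunctionSpaces Literature.Analysis.FluidPDE
open Literature.Analysis.FluidPDE.SawtoothCascade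
open Literature.Analysis.FluidPDE.SawtoothCascade.DriftFree
open Summit.AnomalousDissipation.AnomalousDissipation.Theorems.SawtoothPulseCascade

/-- `K2″` at `(γ, 2)` plus a geometric continuous Lipschitz envelope of the classical linearised response
with ratio `M₁ < (γ²−3)²` give `DriftFree.ApproximateSolution ⟨γ,¼,2,1,2⟩ (γ²−3)`, `γ ∈ [5,8]`: compose the
`L²` envelope (`ApproxResponse.responseL2Envelope`), the bookkeeping of the two smallness integrals
(`DriftFreeApprox.envelopeBookkeeping`) and `DriftFreeApprox.approximateSolution_of_envelopes` on the
classical response produced by `DriftFreeApprox.exists_linearisedResponse`. [folklore] -/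
theorem approximateSolution_two_of_lipEnvelope {γ : ℝ} (hγ : γ ∈ Set.Icc (5 : ℝ) 8)
    (hK2 : Literature.Analysis.FluidPDE.SawtoothCascade.K2PhaseGrowthClassical ⟨γ, 1 / 4, 2, 1, 2⟩ 3)
    (h2 :
      ∃ M₁ K : ℝ, 0 ≤ M₁ ∧ M₁ < (γ ^ 2 - 3) ^ 2 ∧ 0 ≤ K ∧
      ∀ A : ℕ, ∃ ν₀ : ℝ, 0 < ν₀ ∧ ∀ ν ∈ Set.Ioc 0 ν₀, ∀ T' : ℝ,
        horizon (γ ^ 2 - 3) ν A < T' → T' < 1 →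
        ∀ (L : ℝ → UnitAddTorus (Fin 2) → EuclideanSpace ℝ (Fin 2)) (q : ℝ → UnitAddTorus (Fin 2) → ℝ),
          Torus.IsSmoothSpaceTimeOn (Icc 0 T') L → Torus.IsSmoothSpaceTimeOn (Icc 0 T') q →
          (∀ t ∈ Icc 0 T', Torus.IsDivFree (L t)) → L 0 = 0 →
          (∀ t ∈ Icc 0 T', ∀ x, Torus.timeDerivWithin (Icc 0 T') L t x +
            Torus.convect ((⟨γ, 1 / 4, 2, 1, 2⟩ : CascadeParams).field t) (L t) x +
            Torus.convect (L t) ((⟨γ, 1 / 4, 2, 1, 2⟩ : CascadeParams).field t) x =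
              ν • Torus.laplacian (L t) x - Torus.gradient (q t) x +
                ν • Torus.laplacian ((⟨γ, 1 / 4, 2, 1, 2⟩ : CascadeParams).field t) x) →
          ∃ Λ : ℝ → ℝ,
            ContinuousOn Λ (Icc 0 (horizon (γ ^ 2 - 3) ν A)) ∧
            (∀ t ∈ Icc 0 (horizon (γ ^ 2 - 3) ν A), ∀ x : UnitAddTorus (Fin 2),
              ‖Torus.fderiv (L t) x‖ ≤ Λ t) ∧
            ∀ j : ℕ, ∀ t ∈ Icc 0 (horizon (γ ^ 2 - 3) ν A),
              t ∈ Icc (CascadeParams.tStart j) (CascadeParams.tStart (j + 1)) →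
              Λ t ≤ K * ν * ((j : ℝ) + 1) * M₁ ^ (j + 1)) :
    ApproximateSolution ⟨γ, 1 / 4, 2, 1, 2⟩ (γ ^ 2 - 3) := by
  have hγ0 : (0 : ℝ) ≤ γ := le_trans (by norm_num) hγ.1
  have hρN : (2 : ℕ) ∈ Finset.Icc 2 7 := Finset.mem_Icc.2 ⟨le_rfl, by norm_num⟩
  obtain ⟨M₂, K₂, hM₂0, hM₂, hK₂0, H1⟩ := ApproxResponse.responseL2Envelope hγ hρN hK2
  obtain ⟨M₁, K₁, hM₁0, hM₁, hK₁0, H2⟩ := h2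
  refine DriftFreeApprox.approximateSolution_of_envelopes ⟨γ, 1 / 4, 2, 1, 2⟩ hγ0 (by norm_num) (by norm_num) ?_
  intro A ε hε
  obtain ⟨ν₁, hν₁, H1A⟩ := H1 A
  obtain ⟨ν₂, hν₂, H2A⟩ := H2 A
  obtain ⟨ν₃, hν₃, H3A⟩ :=
    DriftFreeApprox.envelopeBookkeeping γ hγ 2 hρN M₁ M₂ K₁ K₂ hM₁0 hM₁ hM₂0 hM₂ hK₁0 hK₂0 A ε hε
  refine ⟨min ν₁ (min ν₂ ν₃), lt_min hν₁ (lt_min hν₂ hν₃), fun ν hν => ?_⟩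
  have hn1 : ν ∈ Set.Ioc 0 ν₁ := ⟨hν.1, hν.2.trans (min_le_left _ _)⟩
  have hn2 : ν ∈ Set.Ioc 0 ν₂ := ⟨hν.1, (hν.2.trans (min_le_right _ _)).trans (min_le_left _ _)⟩
  have hn3 : ν ∈ Set.Ioc 0 ν₃ := ⟨hν.1, (hν.2.trans (min_le_right _ _)).trans (min_le_right _ _)⟩
  set T := horizon (γ ^ 2 - 3) ν A with hT
  have hT0 : 0 ≤ T := CascadeParams.tStart_nonneg _
  have hT1 : T < 1 := CascadeParams.tStart_lt_one _
  set T' : ℝ := (T + 1) / 2 with hT'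
  have hTT' : T < T' := by rw [hT']; linarith
  have hT'1 : T' < 1 := by rw [hT']; linarith
  have hT'0 : 0 < T' := hT0.trans_lt hTT'
  obtain ⟨L, q, hL, hq, hdiv, hL0, hlin⟩ :=
    DriftFreeApprox.exists_linearisedResponse ⟨γ, 1 / 4, 2, 1, 2⟩ (by norm_num) (by norm_num) hν.1 hT'0 hT'1
  obtain ⟨Λ, hΛc, hΛ, hΛle⟩ := H2A ν hn2 T' hTT' hT'1 L q hL hq hdiv hL0 hlin
  have hEle := H1A ν hn1 T' hTT' hT'1 L q hL hq hdiv hL0 hlin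
  set E : ℝ → ℝ := fun t => Real.sqrt (FluidPDE.Torus.vectorL2Sq (L t)) with hE
  have hEc : ContinuousOn E (Set.Icc 0 T) := by
    have h := (hL.continuousOn_integral_norm_sq (convex_Icc 0 T')).mono (Set.Icc_subset_Icc le_rfl hTT'.le)
    exact (Real.continuous_sqrt.comp_continuousOn h).congr fun s _ => rfl
  have henv : ∀ j : ℕ, ∀ t ∈ Set.Icc 0 T, t ∈ Set.Icc (CascadeParams.tStart j) (CascadeParams.tStart (j + 1)) →
      0 ≤ E t ∧ E t ≤ K₂ * ν * ((j : ℝ) + 1) * M₂ ^ (j + 1) ∧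
      0 ≤ Λ t ∧ Λ t ≤ K₁ * ν * ((j : ℝ) + 1) * M₁ ^ (j + 1) :=
    fun j t ht hj => ⟨Real.sqrt_nonneg _, hEle j t ht hj, (norm_nonneg _).trans (hΛ t ht 0), hΛle j t ht hj⟩
  obtain ⟨hint, hdef⟩ := H3A ν hn3 E Λ hEc hΛc henv
  exact ⟨T', hTT', hT'1, L, q, E, Λ, hL, hq, hdiv, hL0, hlin, fun t _ => le_rfl, hΛ, hEc, hΛc, hint, hdef⟩

/-- **S2″ — the Lipschitz envelope at `ρN = 2` from `K2″` alone** (the stub `stub_lipEnvelope_two` of the line's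
skeleton, now unconditional): `lipEnvelope_two_of_caps` with the profile slot caps supplied by `caps_H`, `caps_V`.
[cite: MajdaBertozzi2002, §3.2 Prop. 3.7 (energy estimates for derivatives, uniform in the viscosity)] -/
theorem lipEnvelope_two {γ : ℝ} (hγ : γ ∈ Icc (5 : ℝ) 8)
    (hK2 : Literature.Analysis.FluidPDE.SawtoothCascade.K2PhaseGrowthClassical ⟨γ, 1 / 4, 2, 1, 2⟩ 3) :
    ∃ M₁ K : ℝ, 0 ≤ M₁ ∧ M₁ < (γ ^ 2 - 3) ^ 2 ∧ 0 ≤ K ∧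
      ∀ A : ℕ, ∃ ν₀ : ℝ, 0 < ν₀ ∧ ∀ ν ∈ Set.Ioc 0 ν₀, ∀ T' : ℝ,
        horizon (γ ^ 2 - 3) ν A < T' → T' < 1 →
        ∀ (L : ℝ → UnitAddTorus (Fin 2) → EuclideanSpace ℝ (Fin 2)) (q : ℝ → UnitAddTorus (Fin 2) → ℝ),
          Torus.IsSmoothSpaceTimeOn (Icc 0 T') L → Torus.IsSmoothSpaceTimeOn (Icc 0 T') q →
          (∀ t ∈ Icc 0 T', Torus.IsDivFree (L t)) → L 0 = 0 →
          (∀ t ∈ Icc 0 T', ∀ x, Torus.timeDerivWithin (Icc 0 T') L t x +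
            Torus.convect ((⟨γ, 1 / 4, 2, 1, 2⟩ : CascadeParams).field t) (L t) x +
            Torus.convect (L t) ((⟨γ, 1 / 4, 2, 1, 2⟩ : CascadeParams).field t) x =
              ν • Torus.laplacian (L t) x - Torus.gradient (q t) x +
                ν • Torus.laplacian ((⟨γ, 1 / 4, 2, 1, 2⟩ : CascadeParams).field t) x) →
          ∃ Λ : ℝ → ℝ,
            ContinuousOn Λ (Icc 0 (horizon (γ ^ 2 - 3) ν A)) ∧
            (∀ t ∈ Icc 0 (horizon (γ ^ 2 - 3) ν A), ∀ x : UnitAddTorus (Fin 2),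
              ‖Torus.fderiv (L t) x‖ ≤ Λ t) ∧
            ∀ j : ℕ, ∀ t ∈ Icc 0 (horizon (γ ^ 2 - 3) ν A),
              t ∈ Icc (CascadeParams.tStart j) (CascadeParams.tStart (j + 1)) →
              Λ t ≤ K * ν * ((j : ℝ) + 1) * M₁ ^ (j + 1) := by
  have hγ0 : (0 : ℝ) ≤ γ := le_trans (by norm_num) hγ.1
  exact lipEnvelope_two_of_caps hγ (c₃ := 8 * Real.pi ^ 2) (c₄ := 80 * Real.pi ^ 3 / Real.sqrt (2 * Real.pi))
    (c₅ := 192 * Real.pi ^ 4) (by positivity) (by positivity) (by positivity)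
    (fun ν j => caps_H ⟨γ, 1 / 4, 2, 1, 2⟩ hγ0 (by norm_num) (by norm_num) ν j)
    (fun ν j => caps_V ⟨γ, 1 / 4, 2, 1, 2⟩ hγ0 (by norm_num) (by norm_num) ν j) hK2

/-- **`K2″` at `(γ, 2)` gives `DriftFree.ApproximateSolution ⟨γ,¼,2,1,2⟩ (γ²−3)` for every `γ ∈ [5,8]`** —
unconditionally (no Lipschitz-cap hypothesis): `approximateSolution_two_of_lipEnvelope` + `lipEnvelope_two`. [folklore] -/
theorem approximateSolution_two {γ : ℝ} (hγ : γ ∈ Icc (5 : ℝ) 8)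
    (hK2 : Literature.Analysis.FluidPDE.SawtoothCascade.K2PhaseGrowthClassical ⟨γ, 1 / 4, 2, 1, 2⟩ 3) :
    ApproximateSolution ⟨γ, 1 / 4, 2, 1, 2⟩ (γ ^ 2 - 3) :=
  approximateSolution_two_of_lipEnvelope hγ hK2 (lipEnvelope_two hγ hK2)

/-- **The crux ApproxSol58 on the sub-box `ρN = 2`** (the glue point `(5, 2)` included), from `K2″` alone:
`K2LinearisedCascadeGrowth → ∀ γ ∈ [5,8], ApproximateSolution ⟨γ,¼,2,1,2⟩ (γ²−3)` — exactly the hypothesis of the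
pre-certified re-glue `k3LocalisedClosure_of_approxSol_two`. [folklore] -/
theorem approxSol58_two_of :
    Summit.AnomalousDissipation.AnomalousDissipation.Theses.SawtoothPulseCascade.K2LinearisedCascadeGrowth →
      ∀ γ ∈ Set.Icc (5 : ℝ) 8, ApproximateSolution ⟨γ, 1 / 4, 2, 1, 2⟩ (γ ^ 2 - 3) := by
  intro hK2 γ hγ
  have hγ' : γ ∈ Set.Icc (4 : ℝ) 8 := ⟨le_trans (by norm_num) hγ.1, hγ.2⟩
  exact approximateSolution_two hγ (hK2 γ hγ' 2 (Finset.mem_Icc.2 ⟨le_rfl, by norm_num⟩))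

end Summit.AnomalousDissipation.AnomalousDissipation.Theorems.SawtoothPulseCascade.LipAgmon

end
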